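import Summits.CriticalPhenomena.Ising3DConformalLimit.Theses.ClusterRigidity
import Summits.CriticalPhenomena.Ising3DConformalLimit.Theorems.MonotoneBlockingLimitsAreConformalSummit
import Summits.CriticalPhenomena.Ising3DConformalLimit.Theorems.HyperoctahedralRPExistsScaleCovariantLimitFunnelThroughDoubling
import Summits.CriticalPhenomena.Ising3DConformalLimit.Theorems.HyperoctahedralRPExistsScaleCovariantLimitCompactnessItemMapsDoubling
import Summits.CriticalPhenomena.Ising3DConformalLimit.Theorems.HyperoctahedralRPExistsScaleCovariantLimitFoldedCurrentUniqueness
import Summits.CriticalPhenomena.Ising3DConformalLimit.Theorems.HyperoctahedralRPExistsScaleCovariantLimitFoldedCurrentHeavyScaleDoubling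
import Summits.CriticalPhenomena.Ising3DConformalLimit.Theorems.HyperoctahedralRPExistsScaleCovariantLimitFoldedCurrentSqrtDoubling
import Summits.CriticalPhenomena.Ising3DConformalLimit.Theorems.MirrorHoelderCompactnessTwoPointDoublingStubLeanScalePropagation
import Summits.CriticalPhenomena.Ising3DConformalLimit.Theorems.SynchronousCouplingUniformRegularityMagneticRulerTransfer
import HarnessLib

/-!
# Redirect certificate (r1) — crux `UniformRegularity` (item stmt-CriticalPhenomena-4658), route `ClusterRigidity`

Seat `planner-cstrat-stmt-CriticalPhenomena-4658-r1-0` (crux-strategist, REDIRECT r1, 2026-08-17). Kernel-checked POSITION of the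
crux relative to the sub-problem `S = _root_.Ising3DConformalLimit`, assembled from LANDED theorems only (no sorry):

* §0 the route copies of the crux are one decl (`Iff.rfl`);
* §1 `C ⟺ TwoPointDoubling` (item 6150: all-scale doubling of ONE antitone sequence `g(n) = ⟨σ₀σ_{ne₀}⟩_{β_c(3)}`);
* §2 `S → C` — the CONVERSE probe succeeds by a landed, non-trivial chain (C is a NECESSARY condition of S);
* §3 `S ⟺ C ∧ TD ∧ InversionUpgradeNormalised ∧ NonGaussian` — C is exactly ONE OF FOUR open conjuncts of a landed decomposition of S,
  so `C → S` would need the three open siblings: the crux is strictly BELOW S in the ledger lattice (T1(b) does not fire);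
* §4 RUNGS of C on `ℤ³` itself (where S is open), by name: heavy scales double, `√n`-doubling at every scale, lean windows double;
* §5 the magnetic-ruler transfer `C ⟺ ExcessCorrelationPropagation` (line of record `Lines/Sketch.lean`).
-/

noncomputable section

open Literature.Probability.LatticeModels
open Summit.CriticalPhenomena.Ising3DConformalLimit.Theses
open Summit.CriticalPhenomena.Ising3DConformalLimit.Theorems.LimitsAreConformalSummit
open Summit.CriticalPhenomena.Ising3DConformalLimit.Cruxes.ExistsScaleCovariantLimit

namespace Summit.CriticalPhenomena.Ising3DConformalLimit.Cruxes.UniformRegularity.RedirectR1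

/-! ## §0 One decl, four routes -/

theorem crux_iff_monotoneRG : ClusterRigidity.UniformRegularity ↔ MonotoneRG.UniformRegularity := Iff.rfl
theorem crux_iff_synchronousCoupling : ClusterRigidity.UniformRegularity ↔ SynchronousCoupling.UniformRegularity := Iff.rfl
theorem crux_iff_mirrorHoelder : ClusterRigidity.UniformRegularity ↔ MirrorHoelderCompactness.UniformRegularity := Iff.rfl
theorem nonGaussian_iff_hub : ClusterRigidity.NonGaussian ↔ HyperoctahedralRP.IsingEuclidUpgradeR4NonGaussian := Iff.rfl

/-! ## §1 The crux is item 6150 (landed `ItemMaps.uniformRegularity_iff_doubling`, p120504) -/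

theorem crux_iff_twoPointDoubling :
    ClusterRigidity.UniformRegularity ↔ MirrorHoelderCompactness.TwoPointDoubling :=
  TwoHierarchies.ItemMaps.uniformRegularity_iff_doubling

/-- the same, unfolded to the lattice: `∃ κ > 0, ∀ n ≥ 1, κ·g(n e₀) ≤ g(2n e₀)`. -/
theorem crux_iff_axisDoubling :
    ClusterRigidity.UniformRegularity ↔
      ∃ κ : ℝ, 0 < κ ∧ ∀ n : ℕ, 1 ≤ n →
        κ * criticalTwoPoint 3 (Pi.single 0 (n : ℤ)) ≤ criticalTwoPoint 3 (Pi.single 0 (2 * (n : ℤ))) :=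
  crux_iff_twoPointDoubling

/-! ## §2 The converse probe SUCCEEDS: `S → C` (landed chain S → 1981 → 6150 → 4658) -/

theorem crux_of_summit (h : _root_.Ising3DConformalLimit) : ClusterRigidity.UniformRegularity :=
  crux_iff_twoPointDoubling.2 (Funnel.twoPointDoubling_of_crux (existsScaleCovariantLimit_of_summit h))

theorem not_summit_of_not_crux (h : ¬ ClusterRigidity.UniformRegularity) : ¬ _root_.Ising3DConformalLimit :=
  fun hS => h (crux_of_summit hS)

/-! ## §3 Position: `S ⟺ C ∧ TD ∧ 1982 ∧ 0636` — the crux is one of four open conjuncts -/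

theorem summit_iff_crux_and_three :
    _root_.Ising3DConformalLimit ↔
      ClusterRigidity.UniformRegularity ∧ ClusterRigidity.ClusterSetTotallyDisconnected ∧
        HyperoctahedralRP.InversionUpgradeNormalised ∧ HyperoctahedralRP.IsingEuclidUpgradeR4NonGaussian := by
  rw [summit_iff_three_hubs, FoldedCurrentRepulsion.crux_iff_doubling_and_totallyDisconnected,
    ← crux_iff_twoPointDoubling]
  exact and_assoc

/-- Read with the route's own decl names (`NonGaussian` = 0636 verbatim). -/
theorem summit_iff_crux_and_three' :
    _root_.Ising3DConformalLimit ↔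
      ClusterRigidity.UniformRegularity ∧ ClusterRigidity.ClusterSetTotallyDisconnected ∧
        HyperoctahedralRP.InversionUpgradeNormalised ∧ ClusterRigidity.NonGaussian :=
  summit_iff_crux_and_three

/-- Hence `C → S` is EXACTLY the conjunction of the three open siblings, given C. -/
theorem crux_imp_summit_iff (hC : ClusterRigidity.UniformRegularity) :
    _root_.Ising3DConformalLimit ↔
      ClusterRigidity.ClusterSetTotallyDisconnected ∧ HyperoctahedralRP.InversionUpgradeNormalised ∧
        ClusterRigidity.NonGaussian := by
  rw [summit_iff_crux_and_three']
  exact ⟨fun h => h.2, fun h => ⟨hC, h⟩⟩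

/-- Reg ∧ TD of THIS route = item 1981 (existence of the normalised scale-covariant limit). -/
theorem reg_and_td_iff_exists :
    (ClusterRigidity.UniformRegularity ∧ ClusterRigidity.ClusterSetTotallyDisconnected) ↔
      HyperoctahedralRP.ExistsScaleCovariantLimit := by
  rw [FoldedCurrentRepulsion.crux_iff_doubling_and_totallyDisconnected, ← crux_iff_twoPointDoubling]

/-! ## §4 Rungs of C on `ℤ³` (S open there): landed partial results toward all-scale doubling -/

/-- heavy scales double (p145487; RP level argument). -/
theorem rung_heavyScales : ∀ T : ℝ, 0 < T → ∃ κ : ℝ, 0 < κ ∧ ∀ n : ℕ, 1 ≤ n →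
      T ≤ (n : ℝ) * criticalTwoPoint 3 (Pi.single 0 (n : ℤ)) →
      κ * criticalTwoPoint 3 (Pi.single 0 (n : ℤ)) ≤ criticalTwoPoint 3 (Pi.single 0 (2 * (n : ℤ))) :=
  FoldedCurrentRepulsion.heavyScale_doubling

/-- `√n`-doubling at EVERY scale (p146786; RP + Duminil-Copin–Panis Thm 1.3): the octave loss is `≤ √n / c`. -/
theorem rung_sqrtDoubling : ∃ c : ℝ, 0 < c ∧ ∀ n : ℕ, 1 ≤ n →
      c * (n : ℝ) ^ (-(1 : ℝ) / 2) * criticalTwoPoint 3 (Pi.single 0 (n : ℤ)) ≤ criticalTwoPoint 3 (Pi.single 0 (2 * (n : ℤ))) :=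
  FoldedCurrentRepulsion.sqrt_doubling

/-- lean windows double (p142463; DCP Thm 1.3 engine). -/
theorem rung_leanWindows : ∀ A : ℝ, 0 < A → ∃ κ : ℝ, 0 < κ ∧ ∀ n : ℕ, 1 ≤ n →
      (∀ k : ℕ, 1 ≤ k → k ≤ 8 * n → criticalTwoPoint 3 (Pi.single 0 (k : ℤ)) ≤ A * (k : ℝ) ^ (-(3 : ℝ) / 2)) →
      κ * criticalTwoPoint 3 (Pi.single 0 (n : ℤ)) ≤ criticalTwoPoint 3 (Pi.single 0 (2 * (n : ℤ))) :=
  TwoPointDoubling.Birth.stub_leanScalePropagation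

/-- where C can fail: a non-doubling scale is LIGHT (`not_doubling_level_lt`). -/
theorem rung_localisation : ∃ C : ℝ, 0 < C ∧ ∀ κ : ℝ, 0 < κ → κ ≤ 1 → ∀ n : ℕ, 2 ≤ n →
      criticalTwoPoint 3 (Pi.single 0 (2 * (n : ℤ))) < κ * criticalTwoPoint 3 (Pi.single 0 (n : ℤ)) →
      (n : ℝ) * criticalTwoPoint 3 (Pi.single 0 (n : ℤ)) < 2 * C * κ ^ ((1 : ℝ) / 4) :=
  FoldedCurrentRepulsion.not_doubling_level_lt

/-! ## §5 The magnetic-ruler transfer (line of record; p159733) -/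

theorem crux_iff_excessPropagation_monotoneRG :
    MonotoneRG.UniformRegularity ↔ SynchronousCoupling.UniformRegularity :=
  Theorems.MagneticRuler.monotoneRG_uniformRegularity_iff_synchronousCoupling

/-- `C ⟺ ExcessCorrelationPropagation` in the massive state `(β_c, h > 0)` inside the magnetic window (statement = the landed
`Theorems.MagneticRuler.uniformRegularity_iff_excessPropagation`, re-exported here by term). -/
example :=
  (crux_iff_synchronousCoupling.trans Theorems.MagneticRuler.uniformRegularity_iff_excessPropagation)

end Summit.CriticalPhenomena.Ising3DConformalLimit.Cruxes.UniformRegularity.RedirectR1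

end
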